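import Mathlib
import Literature.RingTheory.MvPolynomial.PlaneCurvesWeakBezout

/-!
# Plane curves: a rational line dividing a rational curve over an algebraic extension

* `isAlgebraic_of_linear_dvd` — if `F ∈ ℚ[z₀, z₁]` is irreducible, `F(x) = 0` in some field,
  and over an algebraic extension `A/ℚ` the rational-direction line `q₀z₀ + q₁z₁ = κ`
  (`q ∈ ℤ² ∖ 0`, `κ ∈ A`) divides `F`, then `q·x` is algebraic over `ℚ` (in the rational
  coordinates `(q₁z₀ − q₀z₁, q·z)` the minimal polynomial of `κ` divides the irreducible `F`).

## References

* [Fulton1969] W. Fulton, *Algebraic Curves*, Benjamin 1969, Ch. 1 §6 (plane curves without common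
  component meet in finitely many points; elimination via Gauss's lemma).
* [Lang2002] S. Lang, *Algebra*, 3rd ed., Springer GTM 211, Ch. IV §2 (Gauss's lemma).
-/

noncomputable section

open scoped Polynomial
open Polynomial

namespace Literature.RingTheory.MvPolynomial.PlaneCurves

/-! ### The endgame over `ℚ`: a rational line dividing `F` over `ℚ̄` -/

section Endgame

/-- If `F ∈ ℚ[z₀, z₁]` is irreducible, `F(x) = 0`, and over an algebraic extension `A` of `ℚ` the
RATIONAL-direction line `q₀ z₀ + q₁ z₁ = κ` (`q ∈ ℤ² ∖ 0`, `κ ∈ A`) divides `F`, then `q·x` is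
algebraic: in the rational coordinates `(u₀, u₁) = (q₁z₀ − q₀z₁, q·z)` every coefficient of
`F'(u₀; u₁)` vanishes at `u₁ = κ`, so the minimal polynomial `μ(u₁)` of `κ` divides the
irreducible `F'`, `F' ∝ μ(u₁)`, and `μ(q·x) = 0`. [folklore] -/
theorem isAlgebraic_of_linear_dvd {A : Type*} [Field A] [CharZero A] [Algebra ℚ A]
    [Algebra.IsIntegral ℚ A] [Infinite A] {F : MvPolynomial (Fin 2) ℚ} (hF : Irreducible F)
    {B : Type*} [Field B] [CharZero B] [Algebra ℚ B] {x : Fin 2 → B}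
    (hFx : MvPolynomial.aeval x F = 0)
    {q : Fin 2 → ℤ} (hq : q ≠ 0) {κ : A}
    (hdvd : (MvPolynomial.C (q 0 : A) * MvPolynomial.X 0 + MvPolynomial.C (q 1 : A) * MvPolynomial.X 1 -
      MvPolynomial.C κ) ∣ MvPolynomial.map (algebraMap ℚ A) F) :
    IsAlgebraic ℚ ((q 0 : B) * x 0 + (q 1 : B) * x 1) := by
  -- the rational change of coordinates `u₀ = q₁ z₀ - q₀ z₁`, `u₁ = q₀ z₀ + q₁ z₁`
  have hNz : (q 0) ^ 2 + (q 1) ^ 2 ≠ 0 := by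
    intro h
    apply hq
    have h0 : q 0 = 0 := by nlinarith [sq_nonneg (q 0), sq_nonneg (q 1)]
    have h1 : q 1 = 0 := by nlinarith [sq_nonneg (q 0), sq_nonneg (q 1)]
    funext i; fin_cases i <;> simp [h0, h1]
  set N : ℚ := (((q 0) ^ 2 + (q 1) ^ 2 : ℤ) : ℚ) with hN
  have hN0 : N ≠ 0 := by rw [hN]; exact_mod_cast hNz
  have hN' : N = (q 0 : ℚ) ^ 2 + (q 1 : ℚ) ^ 2 := by rw [hN]; push_cast; ring
  set φ : Fin 2 → MvPolynomial (Fin 2) ℚ :=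
    ![MvPolynomial.C (q 1 : ℚ) * MvPolynomial.X 0 - MvPolynomial.C (q 0 : ℚ) * MvPolynomial.X 1,
      MvPolynomial.C (q 0 : ℚ) * MvPolynomial.X 0 + MvPolynomial.C (q 1 : ℚ) * MvPolynomial.X 1] with hφ
  set ψ : Fin 2 → MvPolynomial (Fin 2) ℚ :=
    ![(MvPolynomial.C (q 1 : ℚ) * MvPolynomial.X 0 + MvPolynomial.C (q 0 : ℚ) * MvPolynomial.X 1) *
        MvPolynomial.C N⁻¹,
      (MvPolynomial.C (q 1 : ℚ) * MvPolynomial.X 1 - MvPolynomial.C (q 0 : ℚ) * MvPolynomial.X 0) *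
        MvPolynomial.C N⁻¹] with hψ
  have h₁ : ∀ (p : Fin 2 → ℚ) i,
      MvPolynomial.eval (fun j => MvPolynomial.eval p (ψ j)) (φ i) = p i := by
    intro p i
    fin_cases i
    · simp [hφ, hψ]; field_simp; rw [hN']; ring
    · simp [hφ, hψ]; field_simp; rw [hN']; ring
  have h₂ : ∀ (p : Fin 2 → ℚ) i,
      MvPolynomial.eval (fun j => MvPolynomial.eval p (φ j)) (ψ i) = p i := by
    intro p i
    fin_cases i
    · simp [hφ, hψ]; field_simp; rw [hN']; ring
    · simp [hφ, hψ]; field_simp; rw [hN']; ring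
  set Φ := affEquiv φ ψ h₁ h₂ with hΦ
  set F' := Φ.symm F with hF'
  have hFF' : F = Φ F' := by rw [hF', AlgEquiv.apply_symm_apply]
  have hF'irr : Irreducible F' := (MulEquiv.irreducible_iff Φ.symm.toMulEquiv).mpr hF
  -- evaluating `F` through `F'`
  have hevalF : ∀ z : Fin 2 → B,
      MvPolynomial.aeval z F = MvPolynomial.aeval
        ![(q 1 : B) * z 0 - (q 0 : B) * z 1, (q 0 : B) * z 0 + (q 1 : B) * z 1] F' := by
    intro z
    rw [hFF', hΦ, affEquiv_apply, MvPolynomial.comp_aeval_apply]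
    have e : (fun i => MvPolynomial.aeval z (φ i)) =
        ![(q 1 : B) * z 0 - (q 0 : B) * z 1, (q 0 : B) * z 0 + (q 1 : B) * z 1] := by
      funext i
      fin_cases i
      · simp [hφ]
      · simp [hφ]
    rw [e]
  -- `F'(t; κ) = 0` for every `t ∈ A`: the point with coordinates `(t, κ)` lies on the line
  have hNA : (N : A) = (q 0 : A) ^ 2 + (q 1 : A) ^ 2 := by rw [hN']; push_cast; ring
  have hNA0 : (q 0 : A) ^ 2 + (q 1 : A) ^ 2 ≠ 0 := by rw [← hNA]; exact_mod_cast hN0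
  have hvan : ∀ t : A, MvPolynomial.aeval ![t, κ] F' = 0 := by
    intro t
    rw [hF', affEquiv_symm_apply, MvPolynomial.comp_aeval_apply]
    obtain ⟨R, hR⟩ := hdvd
    have key : ∀ p : Fin 2 → A, MvPolynomial.eval p (MvPolynomial.C (q 0 : A) * MvPolynomial.X 0 +
        MvPolynomial.C (q 1 : A) * MvPolynomial.X 1 - MvPolynomial.C κ) = 0 →
        MvPolynomial.aeval p F = 0 := by
      intro p hp0
      have : MvPolynomial.eval p (MvPolynomial.map (algebraMap ℚ A) F) = 0 := by
        rw [hR, MvPolynomial.eval_mul, hp0, zero_mul]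
      rwa [MvPolynomial.eval_map, ← MvPolynomial.aeval_def] at this
    apply key
    simp [hψ]
    rw [hNA]
    field_simp
    ring
  -- all coefficients of `F'` (as a polynomial in `u₀` over `ℚ[u₁]`) vanish at `κ`
  set f' := toPP ℚ F' with hf'
  have hcoeff : ∀ n, Polynomial.aeval κ (f'.coeff n) = 0 := by
    have hzero : f'.map (Polynomial.aeval κ : ℚ[X] →ₐ[ℚ] A).toRingHom = 0 := by
      apply Polynomial.funext
      intro t
      rw [hf', aeval_toPP, Polynomial.eval_zero]
      exact hvan t
    intro n
    have := congrArg (fun g => g.coeff n) hzero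
    simpa [Polynomial.coeff_map] using this
  -- the minimal polynomial of `κ` divides `F'`
  set μ := minpoly ℚ κ with hμ
  have hκint : IsIntegral ℚ κ := Algebra.IsIntegral.isIntegral κ
  have hμdvd : ∀ n, μ ∣ f'.coeff n := fun n => minpoly.dvd ℚ κ (hcoeff n)
  have hCμ : C μ ∣ f' := (Polynomial.C_dvd_iff_dvd_coeff μ f').mpr hμdvd
  obtain ⟨R, hR⟩ := hCμ
  set M := (toPP ℚ).symm (C μ) with hM
  have hF'M : F' = M * (toPP ℚ).symm R := by
    apply (toPP ℚ).injective
    rw [map_mul, hM, AlgEquiv.apply_symm_apply, AlgEquiv.apply_symm_apply, ← hf', hR]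
  -- `M` is not a unit, so the cofactor is a unit `C r`
  have hMnu : ¬ IsUnit M := by
    intro hu
    have hu' : IsUnit (C μ : ℚ[X][X]) := by
      have := hu.map (toPP ℚ)
      rwa [hM, AlgEquiv.apply_symm_apply] at this
    rw [Polynomial.isUnit_C] at hu'
    have hdeg := Polynomial.natDegree_eq_zero_of_isUnit hu'
    have hpos := minpoly.natDegree_pos hκint
    rw [← hμ] at hpos
    omega
  rcases hF'irr.isUnit_or_isUnit hF'M with hu | hu
  · exact absurd hu hMnu
  obtain ⟨r, hr, hRr⟩ := MvPolynomial.isUnit_iff_eq_C_of_isReduced.mp hu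
  -- evaluate at `x`
  have hMeval : ∀ v u : B, MvPolynomial.aeval ![v, u] M = Polynomial.aeval u μ := by
    intro v u
    rw [← aeval_toPP, hM, AlgEquiv.apply_symm_apply, Polynomial.map_C, Polynomial.eval_C]
    rfl
  have key := hFx
  rw [hevalF, hF'M, hRr, map_mul, hMeval, MvPolynomial.aeval_C, mul_eq_zero] at key
  rcases key with key | key
  · exact ⟨μ, minpoly.ne_zero hκint, key⟩
  · exfalso
    rw [map_eq_zero_iff _ (algebraMap ℚ B).injective] at key
    exact hr.ne_zero key

end Endgame

end Literature.RingTheory.MvPolynomial.PlaneCurves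

end
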